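import Summits.ValiantsHypothesis.ValiantsHypothesis.Theses.GCTMult
import Literature.Computability.AlgebraicComplexity.PerDetObstructionKindsNoOccurrence
import Literature.Barriers.ValiantsHypothesis.GCTOccurrenceObstructions

/-!
# ValiantsHypothesis / GCTMult — what Bürgisser–Ikenmeyer–Panova's theorem says about the cruxes
# `GctMultFlip` (stmt-ValiantsHypothesis-0887) and `GctNoMultBarrier` (stmt-ValiantsHypothesis-0890)

Support file (helper theorems, `--supports stmt-ValiantsHypothesis-0887`; nothing is closed). The
route's crux `GctMultFlip` asks, for every `c` and all large permanent sizes `n`, for a highest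
weight `χ` with `mult_χ ℂ[Δ(det_m)] < mult_χ ℂ[Δ(X₀₀^{m-n} per_n)]` at EVERY determinant size `m` of
the quasi-polynomial window `n ≤ m ≤ 2^((log₂ n + c)^c)` (fresh-variable padding
`paddedPerFormLex`, numeric multiplicities `orbitMultiplicity`); its kill criterion `GctNoMultBarrier`
asks for the opposite inequality `mult_χ(per side) ≤ mult_χ(det side)` for all `χ` once
`n^{c₀} ≤ m`. Bürgisser–Ikenmeyer–Panova (J. AMS 32 (2019), Thm. 1.4; fresh-padding threshold
`(n+1)^25 ≤ m`, PROVED in the tree as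
`Literature.Computability.Complexity.no_occurrence_obstructions_succ_holds` and turned into these
letters in `Literature/Computability/AlgebraicComplexity/PerDetObstructionKindsNoOccurrence.lean`)
decides the OCCURRENCE versions of both:

* `GctNoMultBarrier` HOLDS after truncating both multiplicities at `1` (`c₀ = 50`, `n₀ = 2`): the
  occurrence shadow of the open kill criterion is the Literature theorem
  `exists_threshold_min_one_orbitMultiplicity_paddedPer_le_det`; here `min_one_of_gctNoMultBarrier`
  records that the item implies it;
* `not_gctOccurrenceFlip` — `GctMultFlip` with "occurrence obstruction" in place of "flip" is
  FALSE (at `c = 50` the window contains `m = n^50 ≥ (n+1)^25`); the negand is spelled out, no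
  statement is introduced;
* `genuineFlips_of_gctMultFlip`, `flipKinds_of_gctMultFlip` — what `GctMultFlip` therefore demands
  beyond the threshold: flips `1 ≤ mult_det < mult_per` of the vanishing-ideal or pure kind
  (`ObstructionTypes.lean`), and `window_meets_threshold` — that part of the window is nonempty for
  every `c ≥ 50`, `n ≥ 2` (so the demand is not vacuous).

HONEST FRAMING (cell `val-lit`, rung V3): bookkeeping links over PROVED tree theorems; whether any
multiplicity obstruction exists for `(per_n, det_m)`, `m > n ≥ 3`, is OPEN (Bläser–Ikenmeyer 2025
§12.4); nothing here is progress on `VP ≠ VNP`.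
-/

-- layout Summits/ValiantsHypothesis/ValiantsHypothesis forces the duplicated namespace component
set_option linter.dupNamespace false

namespace Summit.ValiantsHypothesis.ValiantsHypothesis.Theorems.GCTMult

open Literature.Computability.AlgebraicComplexity Literature.NumberTheory.DiophantineGeometry
open Summit.ValiantsHypothesis.ValiantsHypothesis.Theses.GCTMult

/-- Arithmetic of the threshold: `(n+1)^25 ≤ n^50` for `2 ≤ n`. [folklore] -/
private theorem succ_pow_le_pow_fifty {n : ℕ} (hn : 2 ≤ n) : (n + 1) ^ 25 ≤ n ^ 50 :=
  calc (n + 1) ^ 25 ≤ (n * n) ^ 25 := Nat.pow_le_pow_left (by nlinarith) 25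
    _ = n ^ 50 := by ring

/-- **`GctNoMultBarrier` and its truncation at `1`.** Bürgisser–Ikenmeyer–Panova Thm. 1.4 (fresh
padding) PROVES the body of the route's open item `GctNoMultBarrier` (stmt-ValiantsHypothesis-0890)
with both `orbitMultiplicity` terms truncated at `1` (`c₀ = 50`, `n₀ = 2`): that is the Literature
theorem `Literature.Computability.AlgebraicComplexity.exists_threshold_min_one_orbitMultiplicity_paddedPer_le_det`
(`PerDetObstructionKindsNoOccurrence.lean`), not restated here. This lemma records the converse
bookkeeping — `GctNoMultBarrier` itself implies that truncated statement (monotonicity of `min 1`) —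
so the truncated form is exactly the part of the kill criterion that BIP settle; the untruncated
statement (no multiplicity FLIP past a polynomial padding) is not known.
[cite: BurgisserIkenmeyerPanovaJAMS2019, Thm. 1.4] -/
theorem min_one_of_gctNoMultBarrier (h : GctNoMultBarrier) :
    ∃ c₀ n₀ : ℕ, ∀ n ≥ n₀, ∀ (m : ℕ) [NeZero m], n ^ c₀ ≤ m → ∀ χ : Weight (MatIdx m),
      min 1 (orbitMultiplicity ℂ (paddedPerFormLex ℂ n m) m χ) ≤
        min 1 (orbitMultiplicity ℂ (detFormLex ℂ m) m χ) := by
  obtain ⟨c₀, n₀, h⟩ := h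
  exact ⟨c₀, n₀, fun n hn m _ hm χ => min_le_min_left 1 (h n hn m hm χ)⟩

/-- **The occurrence version of `GctMultFlip` is false.** There is no `c ↦ n₀` such that every
determinant size of the quasi-polynomial window carries an OCCURRENCE obstruction
(`mult_χ ℂ[Δ(det_m)] = 0 < mult_χ ℂ[Δ(X₀₀^{m-n} per_n)]`): at `c = 50`, `n = max n₀ 2`, the window
`n ≤ m ≤ 2^((log₂ n + 50)^50)` contains `m = n^50` (`pow_le_two_pow_log_add_pow_of_exp`), where
`(n+1)^25 ≤ m` and BIP Thm. 1.4 (fresh padding) leaves no occurrence obstruction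
(`not_isOccurrenceObstructionAt_perDet_of_succ_pow_le`). Numeric fresh-padding twin of the barrier
catalogue's `Literature.Barriers.ValiantsHypothesis.not_occurrenceObstructionRouteQP_holds` (module
form, BIP's padding). The negand is `GctMultFlip` with `IsOccurrenceObstructionAt` in place of the
flip; it is spelled out, not declared. [cite: BurgisserIkenmeyerPanovaJAMS2019, Thm. 1.4] -/
theorem not_gctOccurrenceFlip :
    ¬ ∀ c : ℕ, ∃ n₀ : ℕ, ∀ n ≥ n₀, ∀ (m : ℕ) [NeZero m], n ≤ m → m ≤ 2 ^ ((Nat.log 2 n + c) ^ c) →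
      ∃ χ : Weight (MatIdx m),
        IsOccurrenceObstructionAt (detFormLex ℂ m) (paddedPerFormLex ℂ n m) m χ := by
  intro h
  obtain ⟨n₀, hn₀⟩ := h 50
  set n := max n₀ 2 with hn_def
  have hn2 : 2 ≤ n := le_max_right _ _
  have hpos : 0 < n ^ 50 := Nat.pow_pos (by omega)
  haveI : NeZero (n ^ 50) := NeZero.of_pos hpos
  have h1 : n ≤ n ^ 50 := Nat.le_self_pow (by norm_num) n
  have h2 : n ^ 50 ≤ 2 ^ ((Nat.log 2 n + 50) ^ 50) :=
    Literature.Barriers.ValiantsHypothesis.pow_le_two_pow_log_add_pow_of_exp n 50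
  obtain ⟨χ, hχ⟩ := hn₀ n (le_max_left _ _) (n ^ 50) h1 h2
  exact not_isOccurrenceObstructionAt_perDet_of_succ_pow_le
    ((succ_pow_le_pow_fifty hn2).trans le_rfl) χ hχ

/-- **What `GctMultFlip` demands beyond BIP's threshold: genuine flips.** If the crux holds then,
for every `c`, at all large `n` and every determinant size `m` of the window with `(n+1)^25 ≤ m`,
the flipping weight `χ` satisfies `1 ≤ mult_χ ℂ[Δ(det_m)] < mult_χ ℂ[Δ(X₀₀^{m-n} per_n)]` — it occurs
on BOTH sides (`PerDetMultiplicityObstruction.orbitMultiplicity_det_pos`).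
[cite: BurgisserIkenmeyerPanovaJAMS2019, Thm. 1.4 and §1.4] -/
theorem genuineFlips_of_gctMultFlip (h : GctMultFlip) (c : ℕ) :
    ∃ n₀ : ℕ, ∀ n ≥ n₀, ∀ (m : ℕ) [NeZero m], n ≤ m → m ≤ 2 ^ ((Nat.log 2 n + c) ^ c) →
      (n + 1) ^ 25 ≤ m →
      ∃ χ : Weight (MatIdx m), 0 < orbitMultiplicity ℂ (detFormLex ℂ m) m χ ∧
        orbitMultiplicity ℂ (detFormLex ℂ m) m χ <
          orbitMultiplicity ℂ (paddedPerFormLex ℂ n m) m χ := by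
  obtain ⟨n₀, hn₀⟩ := h c
  refine ⟨n₀, fun n hn m _ hnm hmb h25 => ?_⟩
  obtain ⟨χ, hχ⟩ := hn₀ n hn m hnm hmb
  exact ⟨χ, orbitMultiplicity_det_pos_of_paddedPer_pos h25 (lt_of_le_of_lt (Nat.zero_le _) hχ), hχ⟩

/-- **The kinds `GctMultFlip` can use beyond the threshold**: a vanishing ideal occurrence
obstruction or a pure multiplicity obstruction (typology of `ObstructionTypes.lean`), never an
occurrence obstruction (`PerDetMultiplicityObstruction.isVanishingIdealOccurrence_or_pure`).
[cite: BurgisserIkenmeyerPanovaJAMS2019, Thm. 1.4 and §1.4] -/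
theorem flipKinds_of_gctMultFlip (h : GctMultFlip) (c : ℕ) :
    ∃ n₀ : ℕ, ∀ n ≥ n₀, ∀ (m : ℕ) [NeZero m], n ≤ m → m ≤ 2 ^ ((Nat.log 2 n + c) ^ c) →
      (n + 1) ^ 25 ≤ m →
      ∃ χ : Weight (MatIdx m), PerDetMultiplicityObstruction (k := ℂ) n m χ ∧
        ¬ IsOccurrenceObstructionAt (detFormLex ℂ m) (paddedPerFormLex ℂ n m) m χ ∧
        (IsVanishingIdealOccurrenceObstructionAt (detFormLex ℂ m) (paddedPerFormLex ℂ n m) m χ ∨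
          IsPureMultiplicityObstructionAt (detFormLex ℂ m) (paddedPerFormLex ℂ n m) m χ) := by
  obtain ⟨n₀, hn₀⟩ := h c
  refine ⟨n₀, fun n hn m _ hnm hmb h25 => ?_⟩
  obtain ⟨χ, hχ⟩ := hn₀ n hn m hnm hmb
  have hobs : PerDetMultiplicityObstruction (k := ℂ) n m χ :=
    perDetMultiplicityObstruction_iff.mpr ⟨hnm, hχ⟩
  exact ⟨χ, hobs, hobs.not_isOccurrenceObstructionAt h25, hobs.isVanishingIdealOccurrence_or_pure h25⟩

/-- **The part of the window beyond the threshold is not empty**: for `50 ≤ c` and `2 ≤ n` the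
determinant size `m = n^c` lies in the window (`n ≤ n^c ≤ 2^((log₂ n + c)^c)`,
`pow_le_two_pow_log_add_pow_of_exp`) and satisfies `(n+1)^25 ≤ n^c`; so for every `c ≥ 50` the
crux `GctMultFlip` requires, at infinitely many pairs `(n, n^c)`, a multiplicity obstruction that is
not an occurrence obstruction (`flipKinds_of_gctMultFlip`). [folklore] -/
private theorem window_meets_threshold {c n : ℕ} (hc : 50 ≤ c) (hn : 2 ≤ n) :
    n ≤ n ^ c ∧ n ^ c ≤ 2 ^ ((Nat.log 2 n + c) ^ c) ∧ (n + 1) ^ 25 ≤ n ^ c :=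
  ⟨Nat.le_self_pow (by omega) n,
    Literature.Barriers.ValiantsHypothesis.pow_le_two_pow_log_add_pow_of_exp n c,
    (succ_pow_le_pow_fifty hn).trans (Nat.pow_le_pow_right (by omega) hc)⟩

/-- **`GctMultFlip` needs non-occurrence obstructions at infinitely many pairs**: for every
`c ≥ 50` there is `n₀` such that for every `n ≥ n₀` the pair `(per_n, det_{n^c})` carries a
multiplicity obstruction which is NOT an occurrence obstruction (vanishing-ideal or pure kind).
Composition of `flipKinds_of_gctMultFlip` with `window_meets_threshold`.
[cite: BurgisserIkenmeyerPanovaJAMS2019, Thm. 1.4 and §1.4] -/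
theorem nonOccurrenceObstructions_at_pow_of_gctMultFlip (h : GctMultFlip) {c : ℕ} (hc : 50 ≤ c) :
    ∃ n₀ : ℕ, ∀ n ≥ n₀, ∀ [NeZero (n ^ c)],
      ∃ χ : Weight (MatIdx (n ^ c)), PerDetMultiplicityObstruction (k := ℂ) n (n ^ c) χ ∧
        ¬ IsOccurrenceObstructionAt (detFormLex ℂ (n ^ c)) (paddedPerFormLex ℂ n (n ^ c)) (n ^ c) χ ∧
        (IsVanishingIdealOccurrenceObstructionAt (detFormLex ℂ (n ^ c))
            (paddedPerFormLex ℂ n (n ^ c)) (n ^ c) χ ∨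
          IsPureMultiplicityObstructionAt (detFormLex ℂ (n ^ c))
            (paddedPerFormLex ℂ n (n ^ c)) (n ^ c) χ) := by
  obtain ⟨n₀, hn₀⟩ := flipKinds_of_gctMultFlip h c
  refine ⟨max n₀ 2, fun n hn _ => ?_⟩
  have hn2 : 2 ≤ n := (le_max_right _ _).trans hn
  obtain ⟨hw1, hw2, hw3⟩ := window_meets_threshold hc hn2
  exact hn₀ n ((le_max_left _ _).trans hn) (n ^ c) hw1 hw2 hw3

end Summit.ValiantsHypothesis.ValiantsHypothesis.Theorems.GCTMult
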